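import Summits.MatrixMultiplication.Statement
import Literature.StrongHypotheses.MatrixMultiplication
import Literature.Computability.AlgebraicComplexity.FlatteningBound
import Summits.MatrixMultiplication.MatrixMultiplication.Theorems.FidelityThesis.Negative.AsymptoticRankConjecture
import HarnessLib
import HarnessLib.Audit.TribunalTags

/-!
# Summit `MatrixMultiplication` — bridges of the Strong-Hypothesis Library (D-0034, skeleton)

Summit-side BRIDGE file for the registry `Literature/StrongHypotheses/MatrixMultiplication.lean`: for
every `H` tagged there with `@[strong_hypothesis "MatrixMultiplication.MatrixMultiplication"]`, exactly
ONE bridge tagged `@[summit_bridge "MatrixMultiplication.MatrixMultiplication"]`, concluding the ROOT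
problem decl `_root_.MatrixMultiplication` (`Summits/MatrixMultiplication/MatrixMultiplication/Statement.lean`;
`:= Literature.Computability.AlgebraicComplexity.MatrixMultiplication := omega ℂ = 2`, unfolded by
`MatrixMultiplication_iff`). Written with the `_root_` prefix so that no namespace of the same name can
capture the identifier.

* LANDED bridges (2):
  - `asymptoticRankConjecture_implies_matrixMultiplication` — the asymptotic rank conjecture over `ℂ`
    (`AsymptoticRankConjecture := BCS1997_problem155_negative ℂ`) gives `ω(ℂ) ≤ 2` by the tree theorem
    `Summit.MatrixMultiplication.MatrixMultiplication.Theorems.fidelityThesis_omega_le_two_of_asymptoticRankConjecture`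
    (`Theorems/FidelityThesis/Negative/AsymptoticRankConjecture.lean`: `2^ω ≤ R̃(⟨2,2,2⟩) ≤ 4`), and
    `2 ≤ ω(ℂ)` is `omega_two_le` (`FlatteningBound.lean`).
  - `matrixMultiplicationAllFields_implies_matrixMultiplication` — `∀ K, ω(K) = 2` specialised to `ℂ`
    (`MatrixMultiplicationAllFields.matrixMultiplication`, `MatrixMultiplicationExponent.lean`).
* PRINTED bridges (2), NAMED FACTS (CONVENTIONS §4) to be discharged by a literature-prover as
  `theorem <Name>_holds` in `Summits/MatrixMultiplication/MatrixMultiplication/Theorems/StrongHypotheses<H>Bridge.lean`: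
  - `StrassenAsymptoticRankConjectureImpliesMatrixMultiplication` (CGLVW 2021 §1: Conj. 1.4 ⇒ Conj. 1.3);
  - `CKSUTwoFamiliesConjectureImpliesMatrixMultiplication` (CKSU 2005 Thm. 4.4 with Conj. 4.7).

No new mathematics is proved here; no `sorry`, no axiom.
-/

noncomputable section

namespace Summit.MatrixMultiplication.StrongHypotheses

open Literature.Computability.AlgebraicComplexity
open Literature.StrongHypotheses.MatrixMultiplication

/-! ## Strictly stronger hypotheses — landed bridges -/

/-- **Asymptotic rank conjecture ⟹ `ω = 2`** (landed): `BCS1997_problem155_negative ℂ` applied to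
`⟨2,2,2⟩` in format `4 × 4 × 4` gives `2^ω ≤ R̃(⟨2,2,2⟩) ≤ 4`, i.e. `ω(ℂ) ≤ 2`
(`fidelityThesis_omega_le_two_of_asymptoticRankConjecture`), and `2 ≤ ω(ℂ)` (`omega_two_le`).
"If this is not the case, then in particular `ω(k) = 2`."
[cite: BurgisserClausenShokrollahi1997, Problem 15.5 (p. 420)] -/
@[summit_bridge "MatrixMultiplication.MatrixMultiplication"]
theorem asymptoticRankConjecture_implies_matrixMultiplication :
    AsymptoticRankConjecture → _root_.MatrixMultiplication := fun h =>
  (_root_.MatrixMultiplication_iff).2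
    (le_antisymm
      (Summit.MatrixMultiplication.MatrixMultiplication.Theorems.fidelityThesis_omega_le_two_of_asymptoticRankConjecture
        (asymptoticRankConjecture_iff.1 h))
      (omega_two_le ℂ))

/-- **`ω = 2` over every field ⟹ `ω(ℂ) = 2`** (landed; specialisation to `K = ℂ`,
`MatrixMultiplicationAllFields.matrixMultiplication`). [folklore] -/
@[summit_bridge "MatrixMultiplication.MatrixMultiplication"]
theorem matrixMultiplicationAllFields_implies_matrixMultiplication :
    MatrixMultiplicationAllFields → _root_.MatrixMultiplication := fun h =>
  h.matrixMultiplication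

/-! ## Strictly stronger hypotheses — printed bridges (named facts) -/

/-- **Strassen's asymptotic rank conjecture ⟹ `ω = 2`** — named fact: every concise tight
`t ∈ ℂ^m ⊗ ℂ^m ⊗ ℂ^m` having `R̃(t) = m` (`StrassenAsymptoticRankConjecture`, CGLVW 2021 Conj. 1.4 after
Strassen 1994 §5.3) implies `ω(ℂ) = 2`. Printed: Conner–Gesmundo–Landsberg–Ventura–Wang 2021, §1,
"Question 1.7 ⇒ Question 1.6 ⇒ Question 1.5 ⇒ Conjecture 1.4 ⇒ Conjecture 1.3" with Conjecture 1.3 =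
"`R̃(M_⟨n⟩) = n²`, i.e. `ω = 2`", because the matrix multiplication tensor `M_⟨n⟩ ∈ ℂ^{n²} ⊗ ℂ^{n²} ⊗ ℂ^{n²}`
is concise and tight (BCS 1997, §15.13: "Strassen's conjecture implies that `ω(k) = 2`"). PROOF PLAN for
the discharge `theorem StrassenAsymptoticRankConjectureImpliesMatrixMultiplication_holds`: (i) reindex
`matMulTensor ℂ q q q` (index types `Fin q × Fin q`) to the cubic format `Fin (q*q)` via `finProdFinEquiv`
(`tensorRestrictsTo_of_reindex`, both directions, so `asymptoticRank` is unchanged —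
`asymptoticRank_le_of_polyDegeneratesTo`); (ii) conciseness of `⟨q,q,q⟩` (all three flattenings injective:
each slice family `{M(a,·,·)}` is a family of distinct partial permutation matrices with disjoint supports —
`Literature.Barriers.MatrixMultiplication.IsConcise`); (iii) tightness: with `a = (κ,ν)`, `b = (κ',μ)`,
`c = (μ',ν')` supported on `κ = κ'`, `μ = μ'`, `ν = ν'`, take the injective maps
`τ_A(κ,ν) = q κ + q² ν`, `τ_B(κ',μ) = −q κ' + μ`, `τ_C(μ',ν') = −μ' − q² ν'`, which sum to `0` on the support
and are injective on `Fin q × Fin q`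
(`IsTightSet`, `IsTight.of_isTightSet`); (iv) apply the hypothesis with `m = q*q` to get
`R̃(⟨q,q,q⟩) = q²`, then `advxxz2025_omega_eq_logb_asymptoticRank` / `asymptoticRank_matMulTensor`
(`AsymptoticRankMatMul.lean`: `R̃(⟨q,q,q⟩) = q^ω`) with `q = 2` gives `2^ω = 4`, `ω = 2`.
[cite: ConnerGesmundoLandsbergVenturaWang2020, §1 (Conj. 1.4 ⇒ Conj. 1.3)] -/
@[summit_bridge "MatrixMultiplication.MatrixMultiplication"]
def StrassenAsymptoticRankConjectureImpliesMatrixMultiplication : Prop :=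
  StrassenAsymptoticRankConjecture → _root_.MatrixMultiplication

/-- **CKSU two-families conjecture ⟹ `ω = 2`** — named fact: the "two families" conjecture
(`CKSUTwoFamiliesConjecture`, Cohn–Kleinberg–Szegedy–Umans 2005 Conj. 4.7 = arXiv "Conjecture 26", in the
`ε`-reading over `IsSDPP`) implies `ω(ℂ) = 2`. Printed: CKSU 2005, §4, after Thm. 4.4 (arXiv "Theorem 23":
"If `H` is a finite group with character degrees `{d_k}`, and `n` pairs of subsets `Aᵢ, Bᵢ ⊆ H` satisfy the
simultaneous double product property, then `Σᵢ (|Aᵢ||Bᵢ|)^{ω/2} ≤ (Σ_k d_k^ω)^{3/2}`"): "If `H` is abelian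
Theorem 4.4 implies `ω ≤ (3β − 2)/α`" (`|Aᵢ||Bᵢ| ≥ n^α`, `|H| = n^β`), "the only way to achieve `ω = 2` is
`α = β = 2`. We conjecture that that is possible: Conjecture 4.7". PROOF PLAN for the discharge
`theorem CKSUTwoFamiliesConjectureImpliesMatrixMultiplication_holds`: (i) vendor CKSU Thm. 4.4 in the
abelian case as a Literature named fact `CKSU2005_thm44_abelian : ∀ H [AddCommGroup H] [Fintype H] n
(A B : Fin n → Finset H), IsSDPP A B → Σᵢ ((|A i| |B i| : ℕ) : ℝ)^{ω/2} ≤ |H|^{3/2}` (its printed proof: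
SDPP ⇒ TPP in the wreath product `H^3 ≀ Sym`, CKSU Thm. 4.3, then Thm. 1.8 = the tree's `CKSU2005_thm18`,
Lemma 4.2 = the tree's `IsSDPP.piPow`, and the geometric-to-arithmetic-mean Lemma) — or discharge it;
(ii) given `ε ∈ (0,1)`, pick `n ≥ 2` from the hypothesis; Thm. 4.4 gives `n · n^{(2−ε)ω/2} ≤ n^{3(2+ε)/2}`,
so `1 + (2−ε)ω/2 ≤ 3(2+ε)/2`, `ω ≤ (4+3ε)/(2−ε)`; (iii) let `ε → 0` (`le_of_forall_pos_lt_add`) for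
`ω(ℂ) ≤ 2`, and conclude with `omega_two_le` and `MatrixMultiplication_iff`.
[cite: CohnKleinbergSzegedyUmans2005, Thm. 4.4 and Conj. 4.7 (arXiv Theorem 23, Conjecture 26)] -/
@[summit_bridge "MatrixMultiplication.MatrixMultiplication"]
def CKSUTwoFamiliesConjectureImpliesMatrixMultiplication : Prop :=
  CKSUTwoFamiliesConjecture → _root_.MatrixMultiplication

end Summit.MatrixMultiplication.StrongHypotheses

end
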